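import Summits.QuantumFields.YangMills.Theorems.BalabanUVNodesPortS1P0CInterfaceFam

/-!
# NODE O port — `stub_P0C` (the guarded P0-ℂ letter `P0HolExtAtRecordGL`), brick I: THE SUPPLIER's ROWS AS ONE NAMED PREDICATE `P0FamilyRows` AND THE CLOSER TEMPLATE
# (memo `Cruxes/PortRecordRepresentationS1/Lines/pta_residueW-stub_P0C-hand.md` §4 (M0), §5; over brick H ✓`p0Body_of_families`)

Porter hand `hand-27930-P0C` (g0), `--supports stmt-QuantumFields-27930 --as helper`; count-neutral.  [I] = [Balaban1987RG1], [15] = [Balaban1985Variational], [B9] = [Balaban1985BackgroundPropagators],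
[16] = [Balaban1985UV3].

WHAT.  `P0FamilyRows F a₀ δ₀ c₀ γ₀ γ₁ δ₁ Mc α₀ α₁ ε₂₉ k T TZ AdM AdZ : Prop` — the hypothesis list of ✓`p0Body_of_families` (brick H) as ONE conjunction, VERBATIM: (Z-supp)(Z-loc)(Z-cov) for the
integer family `TZ`, the family-level periodisation identity off the centred wrap class, (P2) for `T · X_full`, (P3), (P4-b)(P4-c)(P4-d) for `T`, (P4-lat) for the torus Möbius pieces of
`T`, (P5) verbatim, (P5ᶜ)-coercivity for `T`.  A predicate WITH PARAMETERS — asserts nothing; it is NOT a re-cut of the registered letter (whose body stays `P0CarrierClauses ∧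
P0CarrierLatticeDecay` over the carriers `TC TY TZY AdM AdZ`, untouched), only the supplier-side packaging of this hand's reduction.  `P0FamilySupply F : Prop` — the rows under the letter's
OWN (Q-ord) prefix with the carriers replaced by the two families.  Theorems: ★ `p0Body_of_familyRows` (rows + `McGuard` + `0 ≤ δ₁` ⟹ the GL body for the Möbius carriers) and
★★ `p0HolExtAtRecordGL_of_familySupply` — THE CLOSER TEMPLATE: `P0FamilySupply F → P0HolExtAtRecordGL F`.  So a supplier of `stub_P0C` proves `P0FamilySupply F` and the by-name closer is
`fun F => p0HolExtAtRecordGL_of_familySupply F (supply F)`.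

HONEST FRAMING.  Packaging of a reduction; NO estimate; nothing of Bałaban asserted, ported or discharged; `P0FamilySupply F` is inhabited NOWHERE today (its rows (P2)(P4-d)(P4-lat)(P5)(P5ᶜ)
are [15] Prop. 9 ∕ Thm 1 (E2) + [B9] §A–§B + [16] (23) content at the record); `stub_P0C` NOT closed; ⟨27930⟩ OPEN; NODE O 0∕1; COUNT 8∕28 · K 1∕4 UNMOVED; finite `𝕋⁴_{L^K}` at
fixed ε — NOT continuum ∕ OS ∕ Clay; **the Yang–Mills mass gap is NOT proved by any of this.**  No `sorry`, no `instance`, no `notation`; standard axioms.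
-/

noncomputable section

open scoped BigOperators Matrix.Norms.L2Operator Topology
open Filter Finset

namespace Summit.QuantumFields.YangMills.Theorems.BalabanUVNodesPortS1

open Summit.QuantumFields.YangMills.Theorems.K0RecordFormatNames
open Literature.MathematicalPhysics.QuantumFieldTheory.Balaban1983to89
open Literature.MathematicalPhysics.QuantumFieldTheory.Balaban1983to89.Node00
open Literature.MathematicalPhysics.QuantumFieldTheory.Balaban1983to89.T4Continuum (T4Family)
open Literature.MathematicalPhysics.QuantumLattice (blockMap)

/-- **THE SUPPLIER's ROWS `P0FamilyRows F a₀ δ₀ c₀ γ₀ γ₁ δ₁ Mc α₀ α₁ ε₂₉ k T TZ AdM AdZ`** — the hypotheses of ✓`p0Body_of_families` as one conjunction (dictionary in the module docstring).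
A predicate WITH PARAMETERS — asserts nothing. [cite: Balaban1987RG1, (1.7) p.261, (1.10) p.262, (1.19) p.263, (1.21) p.264, (2.11) p.267; Balaban1985Variational, Prop. 9 p.309, Thm 1 p.279;
Balaban1985BackgroundPropagators, (3.42) p.399] -/
def P0FamilyRows (F : T4Family) (a₀ δ₀ c₀ γ₀ γ₁ δ₁ : ℝ) (Mc : ℕ) (α₀ α₁ ε₂₉ : ℝ) (k : ℕ)
    (T : (n : ℕ) → (recordDomSys F Mc k (recordK₀ F Mc k + n)).Dom → Sect2.CPair (F.P (recordK₀ F Mc k + n)) (MatA 2) →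
        FluctIdx F k (recordK₀ F Mc k + n) → FluctIdx F k (recordK₀ F Mc k + n) → ℂ)
    (TZ : P0CIntDom → IntBondCfg → P0CIntIdx → P0CIntIdx → ℂ)
    (AdM : (n : ℕ) → (Site (F.P (recordK₀ F Mc k + n)) 0 → (MatA 2)ˣ) →
        Matrix (FluctIdx F k (recordK₀ F Mc k + n)) (FluctIdx F k (recordK₀ F Mc k + n)) ℂ)
    (AdZ : ((Fin 4 → ℤ) → (MatA 2)ˣ) → (Fin 4 → ℤ) × Fin 4 → Matrix (Fin 3) (Fin 3) ℂ) : Prop :=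
  letI θ := thetaFill F a₀ ε₂₉; letI := θ.instVβ₁; letI := θ.instVβ₂; letI := θ.instιβ
  -- (Z-supp) for the integer family
  (∀ (X : P0CIntDom) (f : IntBondCfg) (bi bj : (Fin 4 → ℤ) × Fin 4) (a a' : Fin 3),
      (blockMap (F.L * Mc) bi.1 ∉ X.1 ∨ blockMap (F.L * Mc) bj.1 ∉ X.1) → TZ X f (bi, a) (bj, a') = 0) ∧
  -- (Z-loc) for the integer family
  (∀ (X : P0CIntDom) (f f' : IntBondCfg),
      (∀ zμ : (Fin 4 → ℤ) × Fin 4, zμ.1 ∈ (⋃ a ∈ X.1, B14.Eq213MaximalDomains.cubeExt (F.L ^ (k + 1) * Mc) a 0) →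
        Function.update zμ.1 zμ.2 (zμ.1 zμ.2 + 1) ∈ (⋃ a ∈ X.1, B14.Eq213MaximalDomains.cubeExt (F.L ^ (k + 1) * Mc) a 0) → f zμ = f' zμ) → TZ X f = TZ X f') ∧
  -- (Z-cov) for the integer family
  (∀ û : (Fin 4 → ℤ) → (MatA 2)ˣ, (∀ z, û z ∈ (B12RegularSpaces111SpecialUnitary.suModel 2).Gc) →
      (∀ b : (Fin 4 → ℤ) × Fin 4, IsUnit (AdZ û b)) ∧
      ∀ (X : P0CIntDom) (f : IntBondCfg) (bi bj : (Fin 4 → ℤ) × Fin 4),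
        (Matrix.of fun a a' : Fin 3 => TZ X (intGaugeAct û f) (bi, a) (bj, a')) =
          AdZ û bi * (Matrix.of fun a a' : Fin 3 => TZ X f (bi, a) (bj, a')) * (AdZ û bj)⁻¹) ∧
  -- (Z-bridge) for the FAMILIES (off the centred wrap class, at covered indices of the window): [I] (1.21)
  (∀ (n : ℕ) (Y : (recordDomSys F Mc k (recordK₀ F Mc k + n)).Dom) (hY : Y ∉ recordWrapCtr F Mc k (recordK₀ F Mc k + n))
        (φ : Sect2.CPair (F.P (recordK₀ F Mc k + n)) (MatA 2)) (bi bj : (Fin 4 → ℤ) × Fin 4) (a a' : Fin 3),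
      blockMap (F.L * Mc) bi.1 ∈ intCubes F Mc k (recordK₀ F Mc k + n) Y → blockMap (F.L * Mc) bj.1 ∈ intCubes F Mc k (recordK₀ F Mc k + n) Y →
        T n Y φ (coverBondAt (F.P (recordK₀ F Mc k + n)) k bi, a) (coverBondAt (F.P (recordK₀ F Mc k + n)) k bj, a') =
          TZ ⟨intCubes F Mc k (recordK₀ F Mc k + n) Y, intCubes_mem_p0cIntDom hY⟩ (pullPair F (recordK₀ F Mc k + n) φ) (bi, a) (bj, a')) ∧
  -- (P2) germ identity for the whole-torus member
  (∀ n : ℕ, ∀ᶠ B in 𝓝 (0 : recordW F a₀ ε₂₉ k (recordK₀ F Mc k + n)),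
        ∀ i j : NonB0Idx F k (recordK₀ F Mc k + n),
          T n (g3cFull F Mc k (recordK₀ F Mc k + n)) (recordPairJ F θ k (recordK₀ F Mc k + n) B) i.1 j.1 =
            ((recordPreckLoc F k (recordK₀ F Mc k + n) a₀ (portVkAx F a₀ ε₂₉ k (recordK₀ F Mc k + n) B)
              (hopLinGraph F k (recordK₀ F Mc k + n) (portVkAx F a₀ ε₂₉ k (recordK₀ F Mc k + n) B)) i j : ℝ) : ℂ)) ∧
  -- (P3) covariance for the family
  (∀ (n : ℕ) (u : Site (F.P (recordK₀ F Mc k + n)) 0 → (MatA 2)ˣ),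
      IsUnit (AdM n u) ∧ (∀ i j : FluctIdx F k (recordK₀ F Mc k + n), i.1 ≠ j.1 → AdM n u i j = 0) ∧
      ∀ (X : (recordDomSys F Mc k (recordK₀ F Mc k + n)).Dom) (φ : Sect2.CPair (F.P (recordK₀ F Mc k + n)) (MatA 2)),
        Matrix.of (T n X (Sect2.cAct u φ)) = AdM n u * Matrix.of (T n X φ) * (AdM n u)⁻¹) ∧
  -- (P4-b) support for the family
  (∀ (n : ℕ) (X : (recordDomSys F Mc k (recordK₀ F Mc k + n)).Dom) (φ : Sect2.CPair (F.P (recordK₀ F Mc k + n)) (MatA 2))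
        (i j : FluctIdx F k (recordK₀ F Mc k + n)),
      (B15DeterminingSets.embIter k i.1.src ∉ Sect2.domSites (F.P (recordK₀ F Mc k + n)) Mc (k + 1) X ∨
        B15DeterminingSets.embIter k j.1.src ∉ Sect2.domSites (F.P (recordK₀ F Mc k + n)) Mc (k + 1) X) → T n X φ i j = 0) ∧
  -- (P4-c) (1.7)-locality for the family
  (∀ (n : ℕ) (X : (recordDomSys F Mc k (recordK₀ F Mc k + n)).Dom) (φ ψ : Sect2.CPair (F.P (recordK₀ F Mc k + n)) (MatA 2)),
      Sect2.agreeOnSet (Sect2.domSites (F.P (recordK₀ F Mc k + n)) Mc (k + 1) X) φ ψ → T n X φ = T n X ψ) ∧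
  -- (P4-d) analyticity on the record space for the family
  (∀ (n : ℕ) (X : (recordDomSys F Mc k (recordK₀ F Mc k + n)).Dom) (φ : Sect2.CPair (F.P (recordK₀ F Mc k + n)) (MatA 2)),
      encodeCfg F (recordK₀ F Mc k + n) φ ∈ recordUc F Mc k α₀ α₁ (recordK₀ F Mc k + n) X →
        ∀ i j : FluctIdx F k (recordK₀ F Mc k + n), AnalyticAt ℂ (fun ψ : Sect2.CPair (F.P (recordK₀ F Mc k + n)) (MatA 2) => T n X ψ i j) φ) ∧
  -- (P4-lat) lattice-weighted Schur decay for the torus PIECES (the estimate; (P4-e) follows)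
  (P0CarrierLatticeDecay F δ₀ c₀ δ₁ Mc α₀ α₁ k (fun n => p0cPiece F Mc k (recordK₀ F Mc k + n) (T n))) ∧
  -- (P5) verbatim (carrier-free)
  (∀ n : ℕ, ∀ᶠ B in 𝓝 (0 : recordW F a₀ ε₂₉ k (recordK₀ F Mc k + n)),
        (recordPreckLoc F k (recordK₀ F Mc k + n) a₀ (portVkAx F a₀ ε₂₉ k (recordK₀ F Mc k + n) B)
            (hopLinGraph F k (recordK₀ F Mc k + n) (portVkAx F a₀ ε₂₉ k (recordK₀ F Mc k + n) B))).PosDef ∧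
        ∀ v : NonB0Idx F k (recordK₀ F Mc k + n) → ℝ,
          γ₀ * dotProduct v v ≤
              dotProduct v (Matrix.mulVec (recordPreckLoc F k (recordK₀ F Mc k + n) a₀ (portVkAx F a₀ ε₂₉ k (recordK₀ F Mc k + n) B)
                (hopLinGraph F k (recordK₀ F Mc k + n) (portVkAx F a₀ ε₂₉ k (recordK₀ F Mc k + n) B))) v) ∧
            dotProduct v (Matrix.mulVec (recordPreckLoc F k (recordK₀ F Mc k + n) a₀ (portVkAx F a₀ ε₂₉ k (recordK₀ F Mc k + n) B)
                (hopLinGraph F k (recordK₀ F Mc k + n) (portVkAx F a₀ ε₂₉ k (recordK₀ F Mc k + n) B))) v) ≤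
              γ₁ * dotProduct v v) ∧
  -- (P5ᶜ) complex coercivity for the family
  (∀ (n : ℕ) (X : (recordDomSys F Mc k (recordK₀ F Mc k + n)).Dom) (φ : Sect2.CPair (F.P (recordK₀ F Mc k + n)) (MatA 2)),
      encodeCfg F (recordK₀ F Mc k + n) φ ∈ recordUc F Mc k α₀ α₁ (recordK₀ F Mc k + n) X →
        ∀ v : NonB0Idx F k (recordK₀ F Mc k + n) → ℂ,
          (∀ i : NonB0Idx F k (recordK₀ F Mc k + n),
            B15DeterminingSets.embIter k i.1.1.src ∉ Sect2.domSites (F.P (recordK₀ F Mc k + n)) Mc (k + 1) X → v i = 0) →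
          γ₀ * (∑ i, ‖v i‖ ^ 2) ≤ (∑ i, ∑ j, star (v i) * T n X φ i.1 j.1 * v j).re)

/-- ★ **THE GL BODY FROM THE ROWS**: `P0FamilyRows … T TZ AdM AdZ → McGuard F Mc → 0 ≤ δ₁ →` `P0CarrierClauses … (T · X_full) (pieces of T) (integer pieces of TZ) AdM AdZ ∧ P0CarrierLatticeDecay …`
(= ✓`p0Body_of_families`, brick H, unpacked). [cite: Balaban1987RG1, (2.11) p.267, (1.7) p.261, (1.21) p.264] -/
theorem p0Body_of_familyRows {F : T4Family} {a₀ δ₀ c₀ γ₀ γ₁ δ₁ : ℝ} {Mc : ℕ} {α₀ α₁ ε₂₉ : ℝ} {k : ℕ}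
    {T : (n : ℕ) → (recordDomSys F Mc k (recordK₀ F Mc k + n)).Dom → Sect2.CPair (F.P (recordK₀ F Mc k + n)) (MatA 2) →
        FluctIdx F k (recordK₀ F Mc k + n) → FluctIdx F k (recordK₀ F Mc k + n) → ℂ}
    {TZ : P0CIntDom → IntBondCfg → P0CIntIdx → P0CIntIdx → ℂ}
    {AdM : (n : ℕ) → (Site (F.P (recordK₀ F Mc k + n)) 0 → (MatA 2)ˣ) →
        Matrix (FluctIdx F k (recordK₀ F Mc k + n)) (FluctIdx F k (recordK₀ F Mc k + n)) ℂ}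
    {AdZ : ((Fin 4 → ℤ) → (MatA 2)ˣ) → (Fin 4 → ℤ) × Fin 4 → Matrix (Fin 3) (Fin 3) ℂ}
    (h : P0FamilyRows F a₀ δ₀ c₀ γ₀ γ₁ δ₁ Mc α₀ α₁ ε₂₉ k T TZ AdM AdZ) (hMc : McGuard F Mc) (hδ₁ : 0 ≤ δ₁) :
    P0CarrierClauses F a₀ δ₀ c₀ γ₀ γ₁ Mc α₀ α₁ ε₂₉ k
        (fun n => T n (g3cFull F Mc k (recordK₀ F Mc k + n)))
        (fun n => p0cPiece F Mc k (recordK₀ F Mc k + n) (T n))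
        (p0cIntPiece TZ) AdM AdZ ∧
      P0CarrierLatticeDecay F δ₀ c₀ δ₁ Mc α₀ α₁ k (fun n => p0cPiece F Mc k (recordK₀ F Mc k + n) (T n)) := by
  obtain ⟨hZsupp, hZloc, hZcov, hfam, hP2, hP3, hsupp, hloc, han, hLat, hP5, hcoer⟩ := h
  exact p0Body_of_families F a₀ δ₀ c₀ γ₀ γ₁ δ₁ hδ₁ hMc α₀ α₁ ε₂₉ k T TZ AdM AdZ hZsupp hZloc hZcov hfam hP2 hP3 hsupp hloc han hLat hP5 hcoer

/-- **THE SUPPLIER's LETTER `P0FamilySupply F`** — `P0FamilyRows` under the (Q-ord) prefix of `P0HolExtAtRecordGL` VERBATIM (`∃ c₀ γ₀ γ₁ δ₁` absolute, `∀ δ₀ > 0, ∃ Mth, ∀ Mc ≥ Mth, McGuard →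
∀ a₀ > 0, ⟨the TokE guard⟩ → ∃ α₀ α₁ > 0, ∀ ε₂₉ > 0, ∀ k, ∃ T TZ AdM AdZ, P0FamilyRows …`).  DISPLAYED — asserted for nothing; inhabited nowhere today.
[cite: Balaban1985Variational, Prop. 9 p.309, Thm 1 p.279; Balaban1987RG1, (2.11) p.267, (1.18) p.263] -/
def P0FamilySupply (F : T4Family) : Prop :=
  ∃ c₀ γ₀ γ₁ δ₁ : ℝ, 0 < c₀ ∧ 0 < γ₀ ∧ γ₀ ≤ γ₁ ∧ 0 < δ₁ ∧
  ∀ δ₀ : ℝ, 0 < δ₀ → ∃ Mth : ℕ, ∀ Mc : ℕ, Mth ≤ Mc → McGuard F Mc →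
  ∀ a₀ : ℝ, 0 < a₀ →
  (∃ ε₁ : ℝ, 0 < ε₁ ∧ ∀ (k n : ℕ) (V : GaugeField (F.P (recordK₀ F Mc k + n)) (k + 1) (SU 2)), PlaqSmall ε₁ V →
    UkExists F 2 (recordK₀ F Mc k + n) (k + 1) a₀ V ∧ UniqueUkOrbit F 2 (recordK₀ F Mc k + n) (k + 1) a₀ V) →
  ∃ α₀ α₁ : ℝ, 0 < α₀ ∧ 0 < α₁ ∧
  ∀ ε₂₉ : ℝ, 0 < ε₂₉ → ∀ k : ℕ,
    ∃ (T : (n : ℕ) → (recordDomSys F Mc k (recordK₀ F Mc k + n)).Dom → Sect2.CPair (F.P (recordK₀ F Mc k + n)) (MatA 2) →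
        FluctIdx F k (recordK₀ F Mc k + n) → FluctIdx F k (recordK₀ F Mc k + n) → ℂ)
      (TZ : P0CIntDom → IntBondCfg → P0CIntIdx → P0CIntIdx → ℂ)
      (AdM : (n : ℕ) → (Site (F.P (recordK₀ F Mc k + n)) 0 → (MatA 2)ˣ) →
        Matrix (FluctIdx F k (recordK₀ F Mc k + n)) (FluctIdx F k (recordK₀ F Mc k + n)) ℂ)
      (AdZ : ((Fin 4 → ℤ) → (MatA 2)ˣ) → (Fin 4 → ℤ) × Fin 4 → Matrix (Fin 3) (Fin 3) ℂ),
      P0FamilyRows F a₀ δ₀ c₀ γ₀ γ₁ δ₁ Mc α₀ α₁ ε₂₉ k T TZ AdM AdZ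

/-- ★★ **THE CLOSER TEMPLATE**: `P0FamilySupply F → P0HolExtAtRecordGL F` — the registered stub's letter from the supplier's letter, carriers `(T · X_full, pieces of T, integer pieces of TZ, AdM, AdZ)`.
So `stub_P0C : ∀ F, P0HolExtAtRecordGL F` is `fun F => p0HolExtAtRecordGL_of_familySupply (supply F)` once `supply : ∀ F, P0FamilySupply F` exists (it does NOT today).
[cite: Balaban1985Variational, Prop. 9 p.309; Balaban1987RG1, (2.11) p.267, (1.7) p.261, (1.21) p.264] -/
theorem p0HolExtAtRecordGL_of_familySupply {F : T4Family} (h : P0FamilySupply F) : P0HolExtAtRecordGL F := by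
  obtain ⟨c₀, γ₀, γ₁, δ₁, hc₀, hγ₀, hγ, hδ₁, H⟩ := h
  refine ⟨c₀, γ₀, γ₁, δ₁, hc₀, hγ₀, hγ, hδ₁, fun δ₀ hδ₀ => ?_⟩
  obtain ⟨Mth, HM⟩ := H δ₀ hδ₀
  refine ⟨Mth, fun Mc hMc hG a₀ ha₀ hTok => ?_⟩
  obtain ⟨α₀, α₁, hα₀, hα₁, HK⟩ := HM Mc hMc hG a₀ ha₀ hTok
  refine ⟨α₀, α₁, hα₀, hα₁, fun ε₂₉ hε k => ?_⟩
  obtain ⟨T, TZ, AdM, AdZ, hrows⟩ := HK ε₂₉ hε k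
  exact ⟨_, _, _, _, _, p0Body_of_familyRows hrows hG hδ₁.le⟩

end Summit.QuantumFields.YangMills.Theorems.BalabanUVNodesPortS1

end
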